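import Mathlib
import Summits.BirchSwinnertonDyer.Rank1Residual.O5.MultiplicityAtNine
import HarnessLib

/-!
# Congruence number versus modular degree at conductor exponent two (`9 ∥ N`, `p = 3`): census CONG3,
# finding E-O5-CONG and the record schema (cell `b2b-bsdres`, lane CLASS-CLOSURE, team o5; content =
# planner o5-r2 gen 6 (non-Iwasawa side), placement + dedup = cc-typer-5) — DECIDABLE BOOKKEEPING, NOTHING ASSERTED

HONEST FRAMING (cell `b2b-bsdres`, run/shared/lean/b2b/bsd-rank1-residual/, verbatim in every
file): the goal of the cell is to DELETE the COMBINATION-SHAPED residual classes of the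
Birch–Swinnerton-Dyer formula for ALL analytic-rank `≤ 1` elliptic curves over `ℚ` — "full BSD
formula for every rank `≤ 1` curve in class `C`" assembled STRICTLY from published theorems — so
that the rank-`≤ 1` remainder becomes exactly the CONSTRUCTION-SHAPED classes, which are TYPED
(missing-input `Prop`s), NOT attempted. This is not "finishing BSD". Lane CLASS-CLOSURE: research
routes; census output is EVIDENCE / conjecture items, never a Literature fact; nothing is booked and
no mark of `RESIDUAL-MAP.md` moves.

WHAT THIS FILE RECORDS. For every OPTIMAL elliptic curve `E/ℚ` (Cremona `*1`) of conductor `N ≤ 1070`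
with `9 ∥ N` and `ρ̄_{E,3}` onto (the `295` own-level rows of the MULT1@3 population
`gen5/mult1_pop.tsv`, strata O5 / TPO / TPM), census CONG3 (kit jobs j130161, j130162, j130163, j130164; PARI/GP 2.15.4 script
`gen6/jobs/cong3/cong3.gp`, sha16 `4fc175641e8417ef`) computed: the CONGRUENCE NUMBER `r_E` of
Agashe–Ribet–Stein (the exponent of `S₂(Γ₀(N), ℤ) / (ℤ f_E ⊕ (f_E^⊥ ∩ S₂(Γ₀(N), ℤ)))`, computed on the
Hecke side as `min {c > 0 : c · e_f ∈ 𝕋}` with `𝕋 = ℤ[T_n : n ≤ Sturm bound]` acting on the `+`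
cuspidal modular-symbol lattice — [AgasheRibetStein2012] §2; Stein, *Modular Forms, a Computational
Approach*, Thm. 9.23 for the Sturm generation), the MODULAR DEGREE `m_E` (`ellmoddegree`), and their
`3`-adic valuations; INSTRUMENT CONTROLS: on the `310` control rows with `9 ∤ N` (`3 ∤ N` or
`3 ∥ N`, `N ≤ 300`) `ord₃ r_E = ord₃ m_E` holds in `310 / 310` ([AgasheRibetStein2012] Thm. 3.6 (b)),
`m_E ∣ r_E` in `605 / 605` (Thm. 3.6 (a)), and ARS Table 1 is reproduced (`99a1`: `r = 12, m = 4`;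
`80a1`, `128a1`, `144b1`, `72a1`, `88a1`, `96a1`, `120a1`).
FINDING E-O5-CONG (EVIDENCE, `295 / 295` rows, `0` exceptions; levels `45`–`1062`): with
`e₃(E) := ord₃ r_E − ord₃ m_E` (`∈ {0, 1}` here; ARS Conj. 2.2 `e₃ ≤ ½ ord₃ N = 1` holds in every row,
extending their check), **`e₃(E) = 1` EXACTLY when the local kind of `E` at `3` is Kodaira `III`
(`v₃(Δ) = 3`; `40` rows) or `I₀*` with SUPERSINGULAR quadratic untwist (`v₃(j) > 0`; `23` rows), and
`e₃(E) = 0` for `III*` (`40`), `I₀*` with ordinary untwist (`28`), `Iₙ*` (`164`)**. The law is NOT a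
function of `ρ̄_E|G_ℚ₃` (the kinds `III`, `I₀*`-ordinary and `I₀*`-supersingular share the Serre-weight-`6`
shape after the `ω`-twist) but of the local automorphic type together with the untwist's `a₃ mod 3`.
By [AgasheRibetStein2012] Prop. 2.3 / 5.9 an `e₃ = 1` row forces the failure of mod-`3` multiplicity one
for some `𝔪 ∋ 3` of `𝕋(N)`; the column `mu` (= `dKfull` of the MULT1@3 census for `𝔪 = (3, T_q − a_q(E), U₃)`,
`MultiplicityAtNine`; `0` = row not in that census' range) shows `μ = 2` on all `63` such rows with `μ`
recorded, AND `μ ≥ 2` with `e₃ = 0` on the `III*`, `I₀*`-ordinary and `Iₙ*` (`3 ∣ n`) rows: at `9 ∥ N`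
multiplicity one fails far more often than the congruence number detects (ARS p. 5 ask for exactly such
computations). Typed objects: `CongKind`, `CongRow`, `CongRow.predictedDefect`, `CongRow.FitsCongLaw`
(`m ∣ r`, the recorded valuations are the `3`-adic valuations of the recorded `r`, `m`, the defect law, and
the ARS-Prop.-2.3 reading `e₃ = 1 → μ ≥ 2` where `μ` is recorded), `CongRow.FitsAll`, and ONE `decide +kernel`
theorem over the `295` rows. Nothing about modular forms is proved here: the identification of a row with
`(r_E, m_E)` is the pipeline's, not Lean's. A typed conjecture over honest objects ("for every optimal `E/ℚ`
with `9 ∥ N_E`: `ord₃ r_E − ord₃ m_E = [kind ∈ {III, I₀*-ss}]`") needs a congruence-number notion for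
newforms the tree does not have yet (`Literature/…/HeckeCongruenceModulus.lean` has the abstract
`congruenceModulus`); left to the typer as an interface request, not smuggled here.
References: [AgasheRibetStein2012] A. Agashe, K. Ribet, W. Stein, *The modular degree, congruence primes,
and multiplicity one*, in: Number Theory, Analysis and Geometry (Lang memorial), Springer 2012, 19–49,
doi:10.1007/978-1-4614-1260-1_2 — Conj. 2.2, Prop. 2.3, Thm. 3.6, Prop. 5.9, Table 1; W. Stein, *Modular
Forms, a Computational Approach*, AMS GSM 79 (2007), Thm. 9.23; team file `cells/o5o6/TARGETS.md` §O5
o5-r2 GEN 6; `HOME/b2b-bsdres-o5-r2/gen6/O5-GEN6.md`.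

TYPER PLACEMENT NOTE (cc-typer-5 GEN 5, typer of record O5 §3.5, 2026-08-21): o5-r2 GEN 6's freeze
`HOME/b2b-bsdres-o5-r2/gen6/lean/CongruenceDefectAtNine.lean` (sha16 ff53a7b5c66a3999; ASK A-O5-12c, INBOX 14:29Z;
439 lines > the 400-line cap for Summit files) is landed VERBATIM IN TWO FILES, split "schema / records" as its
author allowed: THIS file = the module docstring of record + the schema (`CongKind`, `CongRow`, `CongRow.OrdThree`,
`predictedDefect`, `FitsCongLaw`, `FitsAll`, `fitsCongLaw_of_fitsAll`), byte-identical; the sibling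
`O5/CongruenceDefectAtNineRows.lean` = the 295 literal rows `congRows` + the three `decide +kernel` theorems
`congRows_fitsCongLaw` / `congRows_length` / `congRows_count_defect_one`, byte-identical. COMPUTATIONAL EVIDENCE
record (`--computational`); nothing about any curve or modular form is asserted; 0 `Prop` nodes; 0 Literature
facts; nothing booked; no mark of `RESIDUAL-MAP.md` moves. The INTERFACE REQUEST at the end of the docstring
(newform-level congruence number `r_f` / modular degree `m_f` before E-O5-CONG / ARS Conj. 2.2 can be typed) is
logged by the typer as a DEFINITION item for a later generation (tree entry points: `congruenceModulus` of
`Literature/…/HeckeCongruenceModulus.lean`; the RT-system `modularDegree` bookkeeping of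
`Literature/NumberTheory/Automorphic/ShimuraCurveRibetTakahashiExactProofs.lean`) — not smuggled here.

-/

set_option autoImplicit false

namespace Summit.BirchSwinnertonDyer.Rank1Residual.O5

/-- Local kind at `3` of an optimal curve with `9 ∥ N`: Kodaira `III`, `III*`, `I₀*` with ordinary resp.
supersingular quadratic untwist (`v₃(j) = 0` resp. `> 0`), `Iₙ*` with `3 ∣ n` resp. `3 ∤ n`. [folklore] -/
inductive CongKind
  | III | IIIstar | I0starOrd | I0starSS | InStarDiv | InStarNotDiv
  deriving DecidableEq, Repr, Inhabited

/-- One CONG3 census row: Cremona label, level, local kind at `3`, congruence number `r_E`, modular degree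
`m_E`, the recorded `ord₃ r_E`, `ord₃ m_E`, and `μ` (= MULT1@3 `dKfull` of `(3, T_q − a_q(E), U₃)`; `0` if not
recorded). DATA, nothing asserted. [folklore] -/
structure CongRow where
  label : String
  level : ℕ
  kind : CongKind
  r : ℕ
  m : ℕ
  ord3r : ℕ
  ord3m : ℕ
  mu : ℕ
  deriving Repr

namespace CongRow

/-- `k` is the exact power of `3` dividing `n` (decidable by `Nat` division; avoids `padicValNat` in the
kernel). [folklore] -/
def OrdThree (k n : ℕ) : Prop := 3 ^ k ∣ n ∧ ¬ 3 ^ (k + 1) ∣ n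

/-- `OrdThree` is decidable. [folklore] -/
instance (k n : ℕ) : Decidable (OrdThree k n) := inferInstanceAs (Decidable (_ ∧ _))

/-- The E-O5-CONG prediction for `ord₃ r_E − ord₃ m_E`: `1` for kinds `III` and `I₀*`-supersingular, else
`0`. [folklore] -/
def predictedDefect (r : CongRow) : ℕ :=
  match r.kind with
  | .III => 1
  | .I0starSS => 1
  | _ => 0

/-- A row FITS: `m ∣ r` (ARS Thm. 3.6 (a) shape), the recorded valuations are the `3`-adic valuations of the
recorded `r`, `m`, the defect law `ord₃ m + predictedDefect = ord₃ r` (so also ARS Conj. 2.2's bound `≤ 1`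
at `9 ∥ N`), and the ARS-Prop.-2.3 reading `predictedDefect = 1 → μ ≥ 2` whenever `μ` is recorded.
[folklore] -/
def FitsCongLaw (r : CongRow) : Prop :=
  r.m ∣ r.r ∧ OrdThree r.ord3r r.r ∧ OrdThree r.ord3m r.m ∧
    r.ord3m + r.predictedDefect = r.ord3r ∧ (r.predictedDefect = 1 → r.mu ≠ 0 → 2 ≤ r.mu)

/-- `FitsCongLaw` is decidable. [folklore] -/
instance (r : CongRow) : Decidable r.FitsCongLaw := inferInstanceAs (Decidable (_ ∧ _ ∧ _ ∧ _ ∧ _))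

/-- A list of rows FITS when every row fits (Bool-valued `List.all`, for `decide +kernel`). [folklore] -/
def FitsAll (rs : List CongRow) : Prop := (rs.all fun r ↦ decide r.FitsCongLaw) = true

/-- `FitsAll` is decidable. [folklore] -/
instance (rs : List CongRow) : Decidable (FitsAll rs) := inferInstanceAs (Decidable (_ = _))

/-- Unpacking `FitsAll`. [folklore] -/
theorem fitsCongLaw_of_fitsAll {rs : List CongRow} (h : FitsAll rs) : ∀ r ∈ rs, r.FitsCongLaw := by
  intro r hr
  have := List.all_eq_true.mp h r hr
  simpa using this

end CongRow

end Summit.BirchSwinnertonDyer.Rank1Residual.O5
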